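/-
[OURS · L1 W4.5(b) · EL♮(3)] SPECIMEN-TC⁺ (quartic) — generic chart algebra of a hypersurface `V(f) ⊂ 𝔸³` at the origin.
-/
import Summits.ResolutionOfSingularities.ResolutionOfSingularities.Theorems.EquisingularLiftEquisingularLiftNatSpecimenQuarticTcDeltaLocalCharts
import HarnessLib

/-!
# [OURS · L1 W4.5(b) · EL♮(3)] SPECIMEN-TC⁺ for the quartic — part H: the affine hypersurface `Spec (k[X]/(f))` at the origin and the
# Stacks-0804 charts of its point blow-up, GENERIC in `f ∈ 𝔪₀`
# (crux `EquisingularLiftNatThree` = stmt-ResolutionOfSingularities-20148; res-L1-w45b-lead-2 DEALS (D2) 2026-08-27T11:55:26Z «NON-VACUITY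
# CERTIFICATES TC⁺»; scoping memo D/res-D-pv-034/SPECIMEN-TCPLUS-SCOPE.md; helper, closes nothing)

HONEST FRAMING. OURS (cell `res-hironaka`, chain w45b, slot W4.5(b)); NOT a statement of any manuscript; AI-written, weaker than expert review.

This is `…SpecimenQuarticTcDeltaLocalCharts` (p519066, written for `f = z² + x⁴ + y⁴`) made generic in the equation `f ∈ 𝔪₀ = (X₀, X₁, X₂)`:
`Df = k[X]/(f)`, the maximal ideal `𝔪̄₀` of the origin (`mbarF`, `isMaximal_mbarF`), the closed point `ptF` of `Spec Df` with
`𝓘_{pt} = 𝔪̄₀~` (`vanishingIdeal_singleton_ptF`), the chart rings `Df[𝔪̄₀/x̄ⱼ]` (`BchF`) with exceptional generator `x̄ⱼ/1` (`excF`) and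
fractions (`frF`), `𝔪̄₀ · Df[𝔪̄₀/x̄ⱼ] = (x̄ⱼ/1)` and the preimage of the point in a chart (`preimage_ptF_eq_zeroLocus`,
`preimage_chart_preimage_ptF`). Consumers: the inner step of the TC⁺ certificate (`f = gL = y₂² + y₁²(1 + y₀⁴)`) and the generic
`Γ`-chart `…TcPlusGammaChartF`.

References: The Stacks Project, Tags 0804, 052Q; Hartshorne II Ex. 3.2.6.
-/

set_option linter.dupNamespace false -- mandated namespace `Summit.<Summit>.<Problem>` of this single-conjunct summit

noncomputable section

open CategoryTheory CategoryTheory.Limits AlgebraicGeometry TopologicalSpace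
open MvPolynomial
open Literature.AlgebraicGeometry.Resolution
open AlgebraicGeometry.Scheme.IdealSheafData
open Summit.ResolutionOfSingularities.ResolutionOfSingularities.Theorems.EquisingularLift

namespace Summit.ResolutionOfSingularities.ResolutionOfSingularities.Cruxes.EquisingularLiftNat.Sections

namespace SpecimenQuarticTcPlus

open SpecimenQuarticTcDelta

universe u

variable (k : Type) [Field k] (f : MvPolynomial (Fin 3) k)

/-! ## The hypersurface ring `Df = k[X]/(f)` and the origin -/

/-- The hypersurface ring `k[X₀,X₁,X₂]/(f)`. [folklore] -/
abbrev Df : Type := MvPolynomial (Fin 3) k ⧸ Ideal.span {f}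

/-- The ideal `𝔪̄₀ = (x̄₀, x̄₁, x̄₂) ⊂ k[X]/(f)` of the origin. [folklore] -/
abbrev mbarF : Ideal (Df k f) := (PointBlowup.originIdeal 2 k).map (Ideal.Quotient.mk (Ideal.span {f}))

/-- The generators `x̄ᵢ` of `𝔪̄₀`. [folklore] -/
def gbarF : Fin 3 → Df k f := fun i => Ideal.Quotient.mk (Ideal.span {f}) (X i)

/-- `(x̄₀, x̄₁, x̄₂) = 𝔪̄₀`. [folklore] -/
theorem span_range_gbarF : Ideal.span (Set.range (gbarF k f)) = mbarF k f := by
  rw [mbarF, PointBlowup.originIdeal, Ideal.map_span, ← Set.range_comp]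
  rfl

variable {f} (hf : f ∈ PointBlowup.originIdeal 2 k)

include hf in
/-- `𝔪̄₀ ⊂ k[X]/(f)` is maximal when `f ∈ 𝔪₀`. [folklore] -/
theorem isMaximal_mbarF : (mbarF k f).IsMaximal := by
  have hsurj : Function.Surjective (Ideal.Quotient.mk (Ideal.span {f})) := Ideal.Quotient.mk_surjective
  rcases Ideal.map_eq_top_or_isMaximal_of_surjective _ hsurj (isMaximal_originIdeal k) with h | h
  · exfalso
    have hc := congrArg (Ideal.comap (Ideal.Quotient.mk (Ideal.span {f}))) h
    rw [Ideal.comap_map_of_surjective _ hsurj, Ideal.comap_top] at hc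
    have hker : Ideal.comap (Ideal.Quotient.mk (Ideal.span {f})) ⊥ ≤ PointBlowup.originIdeal 2 k := by
      rw [← RingHom.ker_eq_comap_bot, Ideal.mk_ker, Ideal.span_le, Set.singleton_subset_iff]
      exact hf
    have : PointBlowup.originIdeal 2 k = ⊤ := by
      rw [← hc]; exact (sup_eq_left.mpr hker).symm
    exact (isMaximal_originIdeal k).ne_top this
  · exact h

/-- The origin as a point of `Spec (k[X]/(f))`. [folklore] -/
def ptF : Spec (CommRingCat.of (Df k f)) := ⟨mbarF k f, (isMaximal_mbarF k hf).isPrime⟩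

/-- The origin is a closed point. [folklore] -/
theorem isClosed_ptF : IsClosed ({ptF k hf} : Set (Spec (CommRingCat.of (Df k f)))) :=
  (PrimeSpectrum.isClosed_singleton_iff_isMaximal _).mpr (isMaximal_mbarF k hf)

/-- `{pt} = V(𝔪̄₀)`. [folklore] -/
theorem singleton_ptF_eq_zeroLocus :
    ({ptF k hf} : Set (Spec (CommRingCat.of (Df k f)))) = PrimeSpectrum.zeroLocus (mbarF k f) := by
  ext q
  rw [Set.mem_singleton_iff]
  constructor
  · rintro rfl
    exact (PrimeSpectrum.mem_zeroLocus _ _).mpr le_rfl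
  · intro hq
    have hle : mbarF k f ≤ q.asIdeal := (PrimeSpectrum.mem_zeroLocus _ _).mp hq
    apply PrimeSpectrum.ext
    exact ((isMaximal_mbarF k hf).eq_of_le q.isPrime.ne_top hle).symm

/-- **`𝓘_{pt} = 𝔪̄₀~`** on `Spec (k[X]/(f))`. [cite: Hartshorne1977, II Example 3.2.6] -/
theorem vanishingIdeal_singleton_ptF :
    vanishingIdeal (⟨{ptF k hf}, isClosed_ptF k hf⟩ : Closeds (Spec (CommRingCat.of (Df k f)))) =
      ofIdealTop ((mbarF k f).map (Scheme.ΓSpecIso (CommRingCat.of (Df k f))).inv.hom) := by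
  have h : (⟨{ptF k hf}, isClosed_ptF k hf⟩ : Closeds (Spec (CommRingCat.of (Df k f)))) =
      ⟨PrimeSpectrum.zeroLocus (mbarF k f : Set (Df k f)), PrimeSpectrum.isClosed_zeroLocus _⟩ :=
    Closeds.ext (singleton_ptF_eq_zeroLocus k hf)
  rw [h]
  have h2 := vanishingIdeal_zeroLocus_Spec (CommRingCat.of (Df k f)) (mbarF k f : Set (Df k f))
  rw [Ideal.span_eq, (isMaximal_mbarF k hf).isPrime.radical] at h2
  exact h2

/-- A point `q` of `Spec (k[X]/(f))` is the origin iff `𝔪̄₀ ≤ q`. [folklore] -/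
theorem eq_ptF_iff (q : Spec (CommRingCat.of (Df k f))) : q = ptF k hf ↔ mbarF k f ≤ q.asIdeal := by
  constructor
  · rintro rfl
    exact le_rfl
  · intro hle
    apply PrimeSpectrum.ext
    exact ((isMaximal_mbarF k hf).eq_of_le q.isPrime.ne_top hle).symm

/-! ## The Stacks-0804 charts of a blow-up of `Spec (k[X]/(f))` at the origin -/

variable (f)

/-- The chart ring `Df[𝔪̄₀/x̄ⱼ]`. [cite: StacksProject, Tag 0804] -/
abbrev BchF (j : Fin 3) : Type := blowupAlgebra (mbarF k f) (gbarF k f j)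

/-- The exceptional generator `x̄ⱼ/1 ∈ Df[𝔪̄₀/x̄ⱼ]`. [cite: StacksProject, Tag 052Q] -/
abbrev excF (j : Fin 3) : BchF k f j := algebraMap (Df k f) (BchF k f j) (gbarF k f j)

/-- `x̄ᵢ ∈ 𝔪̄₀`. [folklore] -/
theorem gbarF_mem (i : Fin 3) : gbarF k f i ∈ mbarF k f := by
  rw [← span_range_gbarF]; exact Ideal.subset_span (Set.mem_range_self i)

/-- The fraction `x̄ᵢ/x̄ⱼ ∈ Df[𝔪̄₀/x̄ⱼ]`. [cite: StacksProject, Tag 052Q] -/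
abbrev frF (j i : Fin 3) : BchF k f j := blowupAlgebra.gen (mbarF k f) (gbarF k f j) (gbarF k f i) (gbarF_mem k f i)

/-- `x̄ᵢ = x̄ⱼ · (x̄ᵢ/x̄ⱼ)` in the chart ring. [cite: StacksProject, Tag 052Q] -/
theorem algebraMap_gbarF_eq (j i : Fin 3) :
    algebraMap (Df k f) (BchF k f j) (gbarF k f i) = excF k f j * frF k f j i :=
  (blowupAlgebra.algebraMap_mul_gen (mbarF k f) (gbarF k f j) (gbarF k f i) (gbarF_mem k f i)).symm

/-- `𝔪̄₀ · Df[𝔪̄₀/x̄ⱼ] = (x̄ⱼ/1)`. [cite: StacksProject, Tag 052Q] -/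
theorem map_mbarF_eq_span (j : Fin 3) :
    (mbarF k f).map (algebraMap (Df k f) (BchF k f j)) = Ideal.span {excF k f j} :=
  map_blowupAlgebra_eq_span (gbarF_mem k f j)

/-- `f̄ = 0` in every chart ring. [folklore] -/
theorem algebraMap_mk_f_eq_zero (j : Fin 3) :
    algebraMap (Df k f) (BchF k f j) (Ideal.Quotient.mk (Ideal.span {f}) f) = 0 := by
  rw [Ideal.Quotient.eq_zero_iff_mem.mpr (Ideal.mem_span_singleton_self _), map_zero]

/-- The structure map on polynomials: `X i ↦ x̄ᵢ/1 = (x̄ⱼ/1)·(x̄ᵢ/x̄ⱼ)`. [folklore] -/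
theorem algebraMap_mk_X (j i : Fin 3) :
    algebraMap (Df k f) (BchF k f j) (Ideal.Quotient.mk (Ideal.span {f}) (X i)) = excF k f j * frF k f j i :=
  algebraMap_gbarF_eq k f j i

variable {f}

/-- **The preimage of the origin in the chart is the exceptional divisor `V(x̄ⱼ/1)`.** [cite: StacksProject, Tag 0804] -/
theorem preimage_ptF_eq_zeroLocus (j : Fin 3) :
    (Spec.map (CommRingCat.ofHom (algebraMap (Df k f) (BchF k f j)))) ⁻¹' {ptF k hf} =
      PrimeSpectrum.zeroLocus {excF k f j} := by
  ext q
  have key : mbarF k f ≤ q.asIdeal.comap (algebraMap (Df k f) (BchF k f j)) ↔ excF k f j ∈ q.asIdeal := by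
    rw [← Ideal.map_le_iff_le_comap, map_mbarF_eq_span, Ideal.span_le, Set.singleton_subset_iff, SetLike.mem_coe]
  constructor
  · intro hq
    have hq' : PrimeSpectrum.comap (algebraMap (Df k f) (BchF k f j)) q = ptF k hf := hq
    have hle : mbarF k f ≤ q.asIdeal.comap (algebraMap (Df k f) (BchF k f j)) := by
      have := congrArg PrimeSpectrum.asIdeal hq'
      rw [PrimeSpectrum.comap_asIdeal] at this
      exact this.symm.le
    exact (PrimeSpectrum.mem_zeroLocus _ _).mpr (Set.singleton_subset_iff.mpr (key.mp hle))
  · intro hq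
    have hq' : excF k f j ∈ q.asIdeal := Set.singleton_subset_iff.mp ((PrimeSpectrum.mem_zeroLocus _ _).mp hq)
    show PrimeSpectrum.comap (algebraMap (Df k f) (BchF k f j)) q = ptF k hf
    apply PrimeSpectrum.ext
    rw [PrimeSpectrum.comap_asIdeal]
    exact ((isMaximal_mbarF k hf).eq_of_le (Ideal.IsPrime.ne_top inferInstance) (key.mpr hq')).symm

/-- **The preimage of the origin read on a chart**: along an open immersion `φ : Spec Df[𝔪̄₀/x̄ⱼ] → B₁` over `Spec Df`,
`φ⁻¹(ρ⁻¹{pt}) = V(x̄ⱼ/1)`. [cite: StacksProject, Tag 0804] -/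
theorem preimage_chart_preimage_ptF {B₁ : Scheme.{0}} {ρ : B₁ ⟶ Spec (CommRingCat.of (Df k f))} (j : Fin 3)
    {φ : Spec (CommRingCat.of (BchF k f j)) ⟶ B₁}
    (hφ : φ ≫ ρ = Spec.map (CommRingCat.ofHom (algebraMap (Df k f) (BchF k f j)))) :
    φ ⁻¹' (ρ ⁻¹' {ptF k hf}) = PrimeSpectrum.zeroLocus {excF k f j} := by
  rw [← Set.preimage_comp, ← TopCat.coe_comp, ← Scheme.Hom.comp_base, hφ]
  exact preimage_ptF_eq_zeroLocus k hf j

/-- Along such a chart, the preimage of a zero locus `V(J) ⊆ Spec Df` is `V(J · Df[𝔪̄₀/x̄ⱼ])`. [folklore] -/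
theorem preimage_chart_preimage_zeroLocus {B₁ : Scheme.{0}} {ρ : B₁ ⟶ Spec (CommRingCat.of (Df k f))} (j : Fin 3)
    {φ : Spec (CommRingCat.of (BchF k f j)) ⟶ B₁}
    (hφ : φ ≫ ρ = Spec.map (CommRingCat.ofHom (algebraMap (Df k f) (BchF k f j)))) (J : Ideal (Df k f)) :
    φ ⁻¹' (ρ ⁻¹' PrimeSpectrum.zeroLocus (J : Set (Df k f))) =
      PrimeSpectrum.zeroLocus ((J.map (algebraMap (Df k f) (BchF k f j)) : Set (BchF k f j))) := by
  rw [← Set.preimage_comp, ← TopCat.coe_comp, ← Scheme.Hom.comp_base, hφ]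
  change PrimeSpectrum.comap (algebraMap (Df k f) (BchF k f j)) ⁻¹' _ = _
  rw [PrimeSpectrum.preimage_comap_zeroLocus, ← PrimeSpectrum.zeroLocus_span (_ '' _)]
  rfl

/-- **The ideal sheaf of the reduced preimage of the origin pulls back to `√(x̄ⱼ/1)~` along a chart.** [cite: StacksProject, Tag 0804] -/
theorem comap_vanishingIdeal_exceptionalF {B₁ : Scheme.{0}} {ρ : B₁ ⟶ Spec (CommRingCat.of (Df k f))} (j : Fin 3)
    {φ : Spec (CommRingCat.of (BchF k f j)) ⟶ B₁} [IsOpenImmersion φ]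
    (hφ : φ ≫ ρ = Spec.map (CommRingCat.ofHom (algebraMap (Df k f) (BchF k f j)))) :
    (vanishingIdeal (⟨ρ ⁻¹' {ptF k hf}, (isClosed_ptF k hf).preimage ρ.continuous⟩ : Closeds B₁)).comap φ =
      ofIdealTop (((Ideal.span {excF k f j}).radical).map (Scheme.ΓSpecIso (CommRingCat.of (BchF k f j))).inv.hom) := by
  rw [comap_vanishingIdeal_of_isOpenImmersion, ← vanishingIdeal_zeroLocus_Spec]
  congr 1
  apply Closeds.ext
  change φ ⁻¹' (ρ ⁻¹' {ptF k hf}) = PrimeSpectrum.zeroLocus {excF k f j}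
  exact preimage_chart_preimage_ptF k hf j hφ

/-! ## Two generic facts about zero loci used chart by chart -/

/-- Off `V(e)`, `V(e·a, e·b) = V(a, b)`. [folklore] -/
theorem zeroLocus_pair_mul_diff {C : Type u} [CommRing C] (e a b : C) :
    PrimeSpectrum.zeroLocus {e * a, e * b} \ PrimeSpectrum.zeroLocus {e} =
      PrimeSpectrum.zeroLocus {a, b} \ PrimeSpectrum.zeroLocus ({e} : Set C) := by
  ext q
  simp only [Set.mem_sdiff, PrimeSpectrum.mem_zeroLocus, Set.insert_subset_iff, Set.singleton_subset_iff,
    SetLike.mem_coe]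
  constructor
  · rintro ⟨⟨h1, h2⟩, h3⟩
    exact ⟨⟨(q.isPrime.mem_or_mem h1).resolve_left h3, (q.isPrime.mem_or_mem h2).resolve_left h3⟩, h3⟩
  · rintro ⟨⟨h1, h2⟩, h3⟩
    exact ⟨⟨Ideal.mul_mem_left _ _ h1, Ideal.mul_mem_left _ _ h2⟩, h3⟩

/-- **Density of the generic point**: for a prime ideal `P` and `t ∉ P`, `V(P) = closure (V(P) ∖ V(t))`. [folklore] -/
theorem closure_zeroLocus_diff_eq_of_isPrime {C : Type u} [CommRing C] (P : Ideal C) [hP : P.IsPrime] {t : C} (ht : t ∉ P) :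
    closure (PrimeSpectrum.zeroLocus (P : Set C) \ PrimeSpectrum.zeroLocus {t}) = PrimeSpectrum.zeroLocus (P : Set C) := by
  apply le_antisymm
  · exact closure_minimal Set.sdiff_subset (PrimeSpectrum.isClosed_zeroLocus _)
  · intro q hq
    let η : PrimeSpectrum C := ⟨P, hP⟩
    have hη : η ∈ PrimeSpectrum.zeroLocus (P : Set C) \ PrimeSpectrum.zeroLocus {t} := by
      refine ⟨(PrimeSpectrum.mem_zeroLocus _ _).mpr le_rfl, fun h => ht ?_⟩
      exact Set.singleton_subset_iff.mp ((PrimeSpectrum.mem_zeroLocus _ _).mp h)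
    have hle : η ⤳ q := by
      rw [← PrimeSpectrum.le_iff_specializes]
      exact (PrimeSpectrum.mem_zeroLocus _ _).mp hq
    exact hle.mem_closed isClosed_closure (subset_closure hη)

/-- If a generator of `J` IS the exceptional generator, `V(J) ∖ V(x̄ⱼ/1) = ∅`. [folklore] -/
theorem zeroLocus_diff_eq_empty_of_mem {C : Type u} [CommRing C] {J : Ideal C} {e : C} (he : e ∈ J) :
    PrimeSpectrum.zeroLocus (J : Set C) \ PrimeSpectrum.zeroLocus {e} = ∅ := by
  ext q
  simp only [Set.mem_sdiff, PrimeSpectrum.mem_zeroLocus, Set.singleton_subset_iff, SetLike.mem_coe, Set.mem_empty_iff_false,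
    iff_false, not_and, not_not]
  exact fun h => h he

end SpecimenQuarticTcPlus

end Summit.ResolutionOfSingularities.ResolutionOfSingularities.Cruxes.EquisingularLiftNat.Sections
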